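import Literature.MathematicalPhysics.QuantumFieldTheory.YangMillsOS
import HarnessLib

/-!
# Local-to-global Morse–Bott bookkeeping by compactness, and continuity of the twisted Wilson action
# (route-independent helper toward the crux `TwistExponentGap.RigidTwistCeiling` ⟨stmt-QuantumFields-24054⟩; free hands of
# width seat ym-line-sfw-p2-w3)

Companion of `TwistExponentGapRigidCeilingOfMorseBott` (✓p775025: `RigidTwistCeiling` BY NAME modulo ONE global Morse–Bott
hypothesis (MB) — finitely many centres, one constant, quadratic growth of the twisted action off their gauge orbits on a small
sublevel set).  This file holds the ROUTE-INDEPENDENT half of the next reduction (no `Theses` import, so route edits do not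
rebuild it); the one-theorem file `TwistExponentGapRigidCeilingOfLocalMorseBott` combines it with ✓p775025:

* `exists_finset_uniform_of_local` — ABSTRACT (any compact space `X`, continuous `A : X → ℝ`, any relation `P x₀ x c`
  antitone in `c`): if every `x₀` with `A x₀ ≤ 0` has a neighbourhood on which `P x₀ · c₀` holds for some `c₀ > 0`, then there
  are a finite set `F ⊆ {A ≤ 0}`, ONE `c > 0` and `t₀ > 0` with `∀ x, A x ≤ t₀ → ∃ x₀ ∈ F, P x₀ x c` (finite subcover of the
  compact `{A ≤ 0}`; off the cover `A` attains a positive minimum).  Consequence for ⟨24054⟩: LOCAL quadratic growth at each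
  twisted-flat configuration separately suffices — «finitely many twisted-flat gauge orbits» and the uniform constant come free.
* `continuous_plaquetteHolonomy_apply`, `continuous_twistedAction` — the inline `z`-twisted Wilson action of the crux
  `Σ_p (r.N − Re tr r.ρ(z_p U_p))` is continuous on `G^{links}` (product topology).
HONEST FRAMING: topology only; nothing here bears on a summit statement or on the Yang–Mills mass gap.
-/

set_option autoImplicit false

noncomputable section

open scoped BigOperators Topology
open Filter
open Literature.MathematicalPhysics.QuantumFieldTheory

namespace Summit.QuantumFields.YangMills.Theorems.TwistExponentGap

/-! ## §1 Local-to-global by compactness (abstract) -/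

/-- **Local ⇒ uniform, by compactness.**  On a compact space, if a continuous `A` and a relation `P x₀ x c` antitone in
`c` are such that every point of `{A ≤ 0}` has a neighbourhood on which `P x₀ · c₀` holds with some `c₀ > 0`, then finitely
many centres in `{A ≤ 0}`, ONE constant `c > 0` and a level `t₀ > 0` serve all of `{A ≤ t₀}`. -/
theorem exists_finset_uniform_of_local {X : Type*} [TopologicalSpace X] [CompactSpace X] {A : X → ℝ}
    (hA : Continuous A) (P : X → X → ℝ → Prop) (hmono : ∀ x₀ x c c', c' ≤ c → P x₀ x c → P x₀ x c')
    (hloc : ∀ x₀, A x₀ ≤ 0 → ∃ N ∈ 𝓝 x₀, ∃ c : ℝ, 0 < c ∧ ∀ x ∈ N, P x₀ x c) :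
    ∃ (F : Finset X) (c t₀ : ℝ), 0 < c ∧ 0 < t₀ ∧ (∀ x₀ ∈ F, A x₀ ≤ 0) ∧
      ∀ x, A x ≤ t₀ → ∃ x₀ ∈ F, P x₀ x c := by
  classical
  set M : Set X := {x | A x ≤ 0} with hM
  have hMc : IsCompact M := (isClosed_le hA continuous_const).isCompact
  choose! Nx hNx cx hcx hPx using hloc
  -- finite subcover of `M` by the interiors of the local neighbourhoods
  obtain ⟨F, hFM, hFcov⟩ := hMc.elim_nhds_subcover (fun x₀ => interior (Nx x₀))
    (fun x₀ hx₀ => interior_mem_nhds.2 (hNx x₀ hx₀))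
  set O : Set X := ⋃ x₀ ∈ F, interior (Nx x₀) with hO
  have hOopen : IsOpen O := isOpen_biUnion fun _ _ => isOpen_interior
  -- one constant for the finitely many centres
  obtain ⟨c, hc, hcle⟩ : ∃ c : ℝ, 0 < c ∧ ∀ x₀ ∈ F, c ≤ cx x₀ := by
    rcases F.eq_empty_or_nonempty with hF | hF
    · exact ⟨1, one_pos, fun x₀ hx₀ => by simp [hF] at hx₀⟩
    · refine ⟨F.inf' hF cx, (Finset.lt_inf'_iff hF).2 fun x₀ hx₀ => hcx x₀ (hFM x₀ hx₀),
        fun x₀ hx₀ => Finset.inf'_le cx hx₀⟩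
  -- a level `t₀ > 0` below which `A` forces membership in the cover
  obtain ⟨t₀, ht₀, hlev⟩ : ∃ t₀ : ℝ, 0 < t₀ ∧ ∀ x, A x ≤ t₀ → x ∈ O := by
    have hKc : IsCompact Oᶜ := hOopen.isClosed_compl.isCompact
    rcases (Oᶜ).eq_empty_or_nonempty with hK | hK
    · refine ⟨1, one_pos, fun x _ => ?_⟩
      by_contra hx
      have : x ∈ Oᶜ := hx
      rw [hK] at this
      exact this
    · obtain ⟨xm, hxmK, hmin⟩ := hKc.exists_isMinOn hK hA.continuousOn
      have hpos : 0 < A xm := by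
        by_contra hle
        push Not at hle
        exact hxmK (hFcov hle)
      refine ⟨A xm / 2, by positivity, fun x hx => ?_⟩
      by_contra hxO
      have h1 : A xm ≤ A x := hmin hxO
      linarith
  refine ⟨F, c, t₀, hc, ht₀, fun x₀ hx₀ => hFM x₀ hx₀, fun x hx => ?_⟩
  obtain ⟨x₀, hx₀F, hxN⟩ := Set.mem_iUnion₂.1 (hlev x hx)
  exact ⟨x₀, hx₀F, hmono x₀ x (cx x₀) c (hcle x₀ hx₀F) (hPx x₀ (hFM x₀ hx₀F) x (interior_subset hxN))⟩

/-! ## §2 Continuity of the twisted action -/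

section Continuity

variable {G : Type} [Group G] [TopologicalSpace G] [IsTopologicalGroup G]

omit [IsTopologicalGroup G] in
/-- Plaquette holonomies depend continuously on the configuration (product topology). -/
theorem continuous_plaquetteHolonomy_apply [ContinuousMul G] [ContinuousInv G] {d L : ℕ} (x : Site d L) (i j : Fin d) :
    Continuous fun U : GaugeConfig d L G => plaquetteHolonomy U x i j := by
  have hev : ∀ e : Edge d L, Continuous fun U : GaugeConfig d L G => U e := fun e => continuous_apply e
  unfold plaquetteHolonomy
  exact (((hev (x, i)).mul (hev (x.shift i, j))).mul ((hev (x.shift j, i)).inv)).mul ((hev (x, j)).inv)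

/-- **The inline `z`-twisted Wilson action of the crux is continuous** on `G^{links}`. -/
theorem continuous_twistedAction (r : LatticeRep G) (L : ℕ) (z : G) (q : {p : Fin 4 × Fin 4 // p.1 < p.2}) :
    Continuous fun U : GaugeConfig 4 (L + 1) G =>
      ∑ p : Plaquette 4 (L + 1), ((r.N : ℝ) - (r.ρ ((if p.2 = q ∧ p.1 q.1.1 = 0 ∧ p.1 q.1.2 = 0 then z else 1) *
        plaquetteHolonomy U p.1 p.2.1.1 p.2.1.2)).trace.re) := by
  refine continuous_finsetSum _ fun p _ => continuous_const.sub ?_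
  have h1 : Continuous fun U : GaugeConfig 4 (L + 1) G =>
      r.ρ ((if p.2 = q ∧ p.1 q.1.1 = 0 ∧ p.1 q.1.2 = 0 then z else 1) * plaquetteHolonomy U p.1 p.2.1.1 p.2.1.2) :=
    r.continuous.comp (continuous_const.mul (continuous_plaquetteHolonomy_apply _ _ _))
  exact Complex.continuous_re.comp h1.matrix_trace

end Continuity

end Summit.QuantumFields.YangMills.Theorems.TwistExponentGap

end
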